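import Literature.NumberTheory.DiophantineGeometry.GenEllDeCriticalLocus
import HarnessLib

/-!
# The critical locus of the FAMILY `t_c = 1/r + c·r^{k+1}/s` on `D_e : r^e = x(1 − x)`
# (GenEllTwo, support piece W5c for the family of S6's ruling #6)

Support for `Summit.ABC.ABC.Theses.IUTThetaPilot.GenEllTwo` = [GenEll] Thm. 2.1 (ii) ⇒ (i) for
`(ℙ¹, [0]+[1]+[∞])` (S. Mochizuki, *Arithmetic elliptic curves in general position*, Math. J.
Okayama Univ. 52 (2010), Thm. 2.1 p. 11; proof pp. 12–13 [cite: MochizukiGenEll2010]), in the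
number-field-only architecture of the abc-iut cell (abc-iut-S6, `GENELLTWO-P1ROUTE.md`, OWNER
RULING #6 + AMENDMENT 2026-08-26: the noncritical Belyi maps are built from the ONE-PARAMETER FAMILY
`t_c := 1/r + c·r^{k+1}/s = (s + c·r^{k+2})/(r·s)`, `c ≠ 0`, `s = 1 − 2x`, on the cover
`D_e : r^e = x(1 − x)`, `e = 2k + 1`, and «W5 must be stated for the family `t_c`»).

This file is the `c`-parametric twin of `GenEllDeCriticalLocus.lean` (the case `c = 1`, whose
definitions `DeCrit.alpha`, `DeCrit.beta` are reused BY NAME). Writing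
`N_c := r²s³·dt_c/dr = −s³ + c·α(r)`, `α(r) = (k+1)r^{k+2} − 2r^{3k+3}`, `β(r) = 1 − 4r^{2k+1}`
(`= s²` on the curve), it proves, over any field in which `2 ≠ 0`, `2k + 1 ≠ 0`, `c ≠ 0`:

* `zeroSetC_eq` — **the zeros of `N_c` on `D_e` are exactly the points
  `Q_θ = ((1 − c·α(θ)/β(θ))/2, θ)`, `θ` a root of the explicit polynomial
  `R_c := c²·α² − β³ ∈ K[X]`** (`R_c(0) = −1`, degree `6k + 6 = 3e + 3`, leading coefficient `4c²`);
  hence the zero set is finite of size `≤ 6k + 6` (`zeroSetC_finite`, `zeroSetC_ncard_le`) and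
  permuted by field homomorphisms (`map_critXC`, `map_RpolyC`, `eval_RpolyC_map`) — so the set of
  critical values `A_c := t_c(R_{t_c})` is finite and Galois-stable;
* `tDen_critPointC_ne_zero` — the zeros of `N_c` avoid the poles `r·s = 0` of `t_c`;
* `NvalC_one`, `eval_RpolyC_one`, `critXC_one` — at `c = 1` everything is the `c = 1` file's.

The companion file `GenEllDeCriticalLocusFamilyReduction.lean` proves the good-prime reduction
statement for the family. Everything is explicit polynomial algebra; no heights, no named facts.
Nothing here bears on the disputed parts of the abc-iut corpus ([GenEll] is refereed and granted by
all sides).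
-/

noncomputable section

open Polynomial

namespace Literature.NumberTheory.DiophantineGeometry.GenEll

namespace DeCrit

section Algebra

variable {K : Type*} [CommRing K]

/-- The ramification function `N_c(x, r) := −s³ + c·α(r)`, `s = 1 − 2x`, of the family member
`t_c = 1/r + c·r^{k+1}/s` on `D_e` in the coordinates `z = (x, r)` (`N_c = r²s³·dt_c/dr`; its zeros
on the affine curve are exactly the ramification points of `t_c`).
[cite: MochizukiGenEll2010, Thm 2.1 proof p.12] -/
def NvalC (k : ℕ) (c : K) (z : K × K) : K := -(1 - 2 * z.1) ^ 3 + c * alpha k z.2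

/-- At `c = 1` the family's ramification function is the one of `GenEllDeCriticalLocus`.
[cite: MochizukiGenEll2010, Thm 2.1 proof p.12] -/
@[simp] theorem NvalC_one (k : ℕ) (z : K × K) : NvalC k (1 : K) z = Nval k z := by
  simp [NvalC, Nval]

/-- `N_c` written out: `N_c(x, r) = −(1 − 2x)³ + c·((k+1)r^{k+2} − 2r^{3k+3})`.
[cite: MochizukiGenEll2010, Thm 2.1 proof p.12] -/
theorem NvalC_eq (k : ℕ) (c x r : K) :
    NvalC k c (x, r) = -(1 - 2 * x) ^ 3 + c * (((k : K) + 1) * r ^ (k + 2) - 2 * r ^ (3 * k + 3)) :=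
  rfl

/-- The one-variable polynomial `R_c := c²·α² − β³ ∈ K[X]`, written out:
`R_c = 4c²X^{6k+6} + 64X^{6k+3} − 4c²(k+1)X^{4k+5} − 48X^{4k+2} + c²(k+1)²X^{2k+4} + 12X^{2k+1} − 1`;
its roots are the `r`-coordinates of the zeros of `N_c` on `D_e`.
[cite: MochizukiGenEll2010, Thm 2.1 proof p.12] -/
def RpolyC (k : ℕ) (c : K) : K[X] :=
  C (4 * c ^ 2) * X ^ (6 * k + 6) + C 64 * X ^ (6 * k + 3)
    - C (4 * c ^ 2 * ((k : K) + 1)) * X ^ (4 * k + 5) - C 48 * X ^ (4 * k + 2)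
    + C (c ^ 2 * ((k : K) + 1) ^ 2) * X ^ (2 * k + 4) + C 12 * X ^ (2 * k + 1) - 1

/-- Evaluation of `R_c`: `R_c(r) = c²·α(r)² − β(r)³`. [cite: MochizukiGenEll2010, Thm 2.1 proof p.12] -/
theorem eval_RpolyC (k : ℕ) (c r : K) :
    (RpolyC k c).eval r = c ^ 2 * alpha k r ^ 2 - beta k r ^ 3 := by
  simp [RpolyC, alpha, beta]
  ring

/-- At `c = 1`, `R_1(r) = R(r)` (the polynomial of `GenEllDeCriticalLocus`).
[cite: MochizukiGenEll2010, Thm 2.1 proof p.12] -/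
theorem eval_RpolyC_one [Algebra ℤ K] (k : ℕ) (r : K) :
    (RpolyC k (1 : K)).eval r = aeval r (Rpoly k) := by
  rw [eval_RpolyC, aeval_Rpoly, one_pow, one_mul]

/-- `R_c(0) = −1`. [cite: MochizukiGenEll2010, Thm 2.1 proof p.12] -/
theorem eval_zero_RpolyC (k : ℕ) (c : K) : (RpolyC k c).eval 0 = -1 := by
  simp [RpolyC]

/-- `deg R_c ≤ 6k + 6`. [cite: MochizukiGenEll2010, Thm 2.1 proof p.12] -/
theorem natDegree_RpolyC_le (k : ℕ) (c : K) : (RpolyC k c).natDegree ≤ 6 * k + 6 := by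
  unfold RpolyC
  (compute_degree!; omega)

/-- The coefficient of `X^{6k+6}` in `R_c` is `4c²`. [cite: MochizukiGenEll2010, Thm 2.1 proof p.12] -/
theorem coeff_RpolyC_top (k : ℕ) (c : K) : (RpolyC k c).coeff (6 * k + 6) = 4 * c ^ 2 := by
  have h1 : 6 * k + 6 ≠ 6 * k + 3 := by omega
  have h2 : 6 * k + 6 ≠ 4 * k + 5 := by omega
  have h3 : 6 * k + 6 ≠ 4 * k + 2 := by omega
  have h4 : 6 * k + 6 ≠ 2 * k + 4 := by omega
  have h5 : 6 * k + 6 ≠ 2 * k + 1 := by omega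
  have h6 : 6 * k + 6 ≠ 0 := by omega
  rw [RpolyC]
  simp only [coeff_add, coeff_sub, coeff_C_mul, coeff_X_pow, coeff_one, if_true, if_neg h1,
    if_neg h2, if_neg h3, if_neg h4, if_neg h5, if_neg h6]
  ring

/-- `deg R_c = 6k + 6` (`= 3e + 3`) as soon as `4c² ≠ 0`. [cite: MochizukiGenEll2010, Thm 2.1 proof p.12] -/
theorem natDegree_RpolyC (k : ℕ) {c : K} (hc : (4 : K) * c ^ 2 ≠ 0) :
    (RpolyC k c).natDegree = 6 * k + 6 :=
  natDegree_eq_of_le_of_coeff_ne_zero (natDegree_RpolyC_le k c) (by rwa [coeff_RpolyC_top])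

/-- The leading coefficient of `R_c` is `4c²` (when `4c² ≠ 0`). [cite: MochizukiGenEll2010, Thm 2.1 proof p.12] -/
theorem leadingCoeff_RpolyC (k : ℕ) {c : K} (hc : (4 : K) * c ^ 2 ≠ 0) :
    (RpolyC k c).leadingCoeff = 4 * c ^ 2 := by
  rw [leadingCoeff, natDegree_RpolyC k hc, coeff_RpolyC_top]

/-- `R_c ≠ 0` (its constant term is `−1`). [cite: MochizukiGenEll2010, Thm 2.1 proof p.12] -/
theorem RpolyC_ne_zero [Nontrivial K] (k : ℕ) (c : K) : RpolyC k c ≠ 0 := fun h => by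
  have := eval_zero_RpolyC k c
  rw [h, eval_zero] at this
  exact one_ne_zero (neg_eq_zero.mp this.symm)

section Map

variable {L : Type*} [CommRing L] (f : K →+* L)

/-- `R_c` is mapped to `R_{f c}` by a ring homomorphism `f`. [cite: MochizukiGenEll2010, Thm 2.1 proof p.12] -/
theorem map_RpolyC (k : ℕ) (c : K) : (RpolyC k c).map f = RpolyC k (f c) := by
  simp [RpolyC, Polynomial.map_sub, Polynomial.map_add, Polynomial.map_mul, Polynomial.map_pow,
    map_ofNat, map_natCast]

end Map

end Algebra

section Field

variable {K : Type*} [Field K]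

/-- On `D_e` the ramification function of `t_c` is `N_c = −s·β(r) + c·α(r)` (`s = 1 − 2x`,
`s² = β(r)`). [cite: MochizukiGenEll2010, Thm 2.1 proof p.12] -/
theorem NvalC_eq_of_mem (k : ℕ) (c : K) {x r : K} (h : r ^ (2 * k + 1) = x * (1 - x)) :
    NvalC k c (x, r) = -((1 - 2 * x) * beta k r) + c * alpha k r := by
  simp only [NvalC, beta]
  linear_combination (-4 * (1 - 2 * x)) * h

/-- A zero of `N_c` on `D_e` has `r`-coordinate a root of `R_c = c²α² − β³`. [cite: MochizukiGenEll2010, Thm 2.1 proof p.12] -/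
theorem eval_RpolyC_eq_zero_of_NvalC_eq_zero (k : ℕ) (c : K) {x r : K}
    (h : r ^ (2 * k + 1) = x * (1 - x)) (hN : NvalC k c (x, r) = 0) :
    (RpolyC k c).eval r = 0 := by
  rw [eval_RpolyC]
  rw [NvalC_eq_of_mem k c h] at hN
  have hb := beta_eq_sq_of_mem k h
  linear_combination (c * alpha k r + (1 - 2 * x) * beta k r) * hN - (beta k r) ^ 2 * hb

/-- A root `θ` of `R_c` is nonzero (`R_c(0) = −1`). [cite: MochizukiGenEll2010, Thm 2.1 proof p.12] -/
theorem rootC_ne_zero (k : ℕ) (c : K) {θ : K} (hR : (RpolyC k c).eval θ = 0) : θ ≠ 0 := by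
  rintro rfl
  rw [eval_zero_RpolyC] at hR
  norm_num at hR

/-- At a root `θ` of `R_c`, `β(θ) ≠ 0` provided `e = 2k+1 ≠ 0` in `K` and `c ≠ 0` (so the zeros of
`N_c` stay away from the Weierstrass points `s = 0`). [cite: MochizukiGenEll2010, Thm 2.1 proof p.12] -/
theorem beta_ne_zero_of_rootC (k : ℕ) (he : ((2 * k + 1 : ℕ) : K) ≠ 0) {c : K} (hc : c ≠ 0) {θ : K}
    (hR : (RpolyC k c).eval θ = 0) : beta k θ ≠ 0 := by
  intro hb
  have hθ : θ ≠ 0 := by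
    rintro rfl
    simp [beta] at hb
  rw [eval_RpolyC, hb] at hR
  have ha : alpha k θ = 0 := by
    have : (c * alpha k θ) ^ 2 = 0 := by linear_combination hR
    simpa [hc] using pow_eq_zero_iff (two_ne_zero) |>.mp this
  have h2a : (2 : K) * alpha k θ = ((2 * k + 1 : ℕ) : K) * θ ^ (k + 2) := by
    simp only [alpha, beta] at hb ⊢
    push_cast
    linear_combination θ ^ (k + 2) * hb
  rw [ha, mul_zero] at h2a
  exact mul_ne_zero he (pow_ne_zero _ hθ) h2a.symm

/-- At a root `θ` of `R_c` (`c ≠ 0`, `2k+1 ≠ 0`), `α(θ) ≠ 0`. [cite: MochizukiGenEll2010, Thm 2.1 proof p.12] -/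
theorem alpha_ne_zero_of_rootC (k : ℕ) (he : ((2 * k + 1 : ℕ) : K) ≠ 0) {c : K} (hc : c ≠ 0)
    {θ : K} (hR : (RpolyC k c).eval θ = 0) : alpha k θ ≠ 0 := by
  intro ha
  have hb := beta_ne_zero_of_rootC k he hc hR
  rw [eval_RpolyC, ha] at hR
  have : beta k θ ^ 3 = 0 := by simpa using hR
  exact hb (pow_eq_zero_iff (by norm_num) |>.mp this)

/-- `s`-coordinate `s_θ := c·α(θ)/β(θ)` of the zero of `N_c` above a root `θ` of `R_c`.
[cite: MochizukiGenEll2010, Thm 2.1 proof p.12] -/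
def critSC (k : ℕ) (c θ : K) : K := c * alpha k θ / beta k θ

/-- `x`-coordinate `x_θ := (1 − s_θ)/2` of the zero of `N_c` above a root `θ` of `R_c`.
[cite: MochizukiGenEll2010, Thm 2.1 proof p.12] -/
def critXC (k : ℕ) (c θ : K) : K := (1 - critSC k c θ) / 2

/-- The zero `Q_θ := (x_θ, θ)` of `N_c` on `D_e` above a root `θ` of `R_c` (a ramification point of
`t_c`). [cite: MochizukiGenEll2010, Thm 2.1 proof p.12] -/
def critPointC (k : ℕ) (c θ : K) : K × K := (critXC k c θ, θ)

/-- At `c = 1`, `s_θ` is the one of `GenEllDeCriticalLocus`. [cite: MochizukiGenEll2010, Thm 2.1 proof p.12] -/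
@[simp] theorem critSC_one (k : ℕ) (θ : K) : critSC k (1 : K) θ = critS k θ := by
  simp [critSC, critS]

/-- At `c = 1`, `x_θ` is the one of `GenEllDeCriticalLocus`. [cite: MochizukiGenEll2010, Thm 2.1 proof p.12] -/
@[simp] theorem critXC_one (k : ℕ) (θ : K) : critXC k (1 : K) θ = critX k θ := by
  simp [critXC, critX]

/-- At `c = 1`, `Q_θ` is the one of `GenEllDeCriticalLocus`. [cite: MochizukiGenEll2010, Thm 2.1 proof p.12] -/
@[simp] theorem critPointC_one (k : ℕ) (θ : K) : critPointC k (1 : K) θ = critPoint k θ := by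
  simp [critPointC, critPoint]

/-- First coordinate of `Q_θ`. [cite: MochizukiGenEll2010, Thm 2.1 proof p.12] -/
@[simp] theorem critPointC_fst (k : ℕ) (c θ : K) : (critPointC k c θ).1 = critXC k c θ := rfl

/-- Second coordinate of `Q_θ`. [cite: MochizukiGenEll2010, Thm 2.1 proof p.12] -/
@[simp] theorem critPointC_snd (k : ℕ) (c θ : K) : (critPointC k c θ).2 = θ := rfl

/-- `1 − 2x_θ = s_θ`. [cite: MochizukiGenEll2010, Thm 2.1 proof p.12] -/
theorem one_sub_two_mul_critXC (k : ℕ) (h2 : (2 : K) ≠ 0) (c θ : K) :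
    1 - 2 * critXC k c θ = critSC k c θ := by
  unfold critXC
  field_simp
  ring

/-- `s_θ² = β(θ)` at a root of `R_c`. [cite: MochizukiGenEll2010, Thm 2.1 proof p.12] -/
theorem critSC_sq (k : ℕ) (he : ((2 * k + 1 : ℕ) : K) ≠ 0) {c : K} (hc : c ≠ 0) {θ : K}
    (hR : (RpolyC k c).eval θ = 0) : critSC k c θ ^ 2 = beta k θ := by
  have hb := beta_ne_zero_of_rootC k he hc hR
  rw [eval_RpolyC] at hR
  unfold critSC
  rw [div_pow, div_eq_iff (pow_ne_zero 2 hb)]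
  linear_combination hR

/-- The point `Q_θ` lies on `D_e`: `θ^{2k+1} = x_θ(1 − x_θ)`. [cite: MochizukiGenEll2010, Thm 2.1 proof p.12] -/
theorem critPointC_mem (k : ℕ) (h2 : (2 : K) ≠ 0) (he : ((2 * k + 1 : ℕ) : K) ≠ 0) {c : K}
    (hc : c ≠ 0) {θ : K} (hR : (RpolyC k c).eval θ = 0) :
    θ ^ (2 * k + 1) = critXC k c θ * (1 - critXC k c θ) := by
  have h4 : (4 : K) ≠ 0 := by
    have := mul_ne_zero h2 h2
    norm_num at this
    exact this
  have hcs := critSC_sq k he hc hR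
  have hx : critXC k c θ * (1 - critXC k c θ) = (1 - critSC k c θ ^ 2) / 4 := by
    unfold critXC
    field_simp
    ring
  rw [hx, hcs, beta]
  field_simp
  ring

/-- `N_c(Q_θ) = 0`. [cite: MochizukiGenEll2010, Thm 2.1 proof p.12] -/
theorem NvalC_critPointC (k : ℕ) (h2 : (2 : K) ≠ 0) (he : ((2 * k + 1 : ℕ) : K) ≠ 0) {c : K}
    (hc : c ≠ 0) {θ : K} (hR : (RpolyC k c).eval θ = 0) : NvalC k c (critPointC k c θ) = 0 := by
  have hb := beta_ne_zero_of_rootC k he hc hR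
  rw [eval_RpolyC] at hR
  rw [NvalC, critPointC_fst, critPointC_snd, one_sub_two_mul_critXC k h2, critSC]
  field_simp
  linear_combination (-(c * alpha k θ)) * hR

/-- Uniqueness: a zero `(x, r)` of `N_c` on `D_e` is the point `Q_r`. [cite: MochizukiGenEll2010, Thm 2.1 proof p.12] -/
theorem fst_eq_critXC_of_NvalC_eq_zero (k : ℕ) (h2 : (2 : K) ≠ 0) (he : ((2 * k + 1 : ℕ) : K) ≠ 0)
    {c : K} (hc : c ≠ 0) {x r : K} (h : r ^ (2 * k + 1) = x * (1 - x))
    (hN : NvalC k c (x, r) = 0) : x = critXC k c r := by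
  have hR := eval_RpolyC_eq_zero_of_NvalC_eq_zero k c h hN
  have hb := beta_ne_zero_of_rootC k he hc hR
  rw [NvalC_eq_of_mem k c h] at hN
  have hs : 1 - 2 * x = critSC k c r := by
    rw [critSC, eq_div_iff hb]
    linear_combination -hN
  unfold critXC
  rw [← hs]
  field_simp
  ring

/-- **The zero set of `N_c` on `D_e`** is the image of the root set of `R_c` under `θ ↦ Q_θ`
(over any field with `2 ≠ 0`, `2k+1 ≠ 0`, for `c ≠ 0`). [cite: MochizukiGenEll2010, Thm 2.1 proof p.12] -/
theorem zeroSetC_eq (k : ℕ) (h2 : (2 : K) ≠ 0) (he : ((2 * k + 1 : ℕ) : K) ≠ 0) {c : K} (hc : c ≠ 0) :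
    {z : K × K | z.2 ^ (2 * k + 1) = z.1 * (1 - z.1) ∧ NvalC k c z = 0} =
      critPointC k c '' ((RpolyC k c).rootSet K) := by
  ext ⟨x, r⟩
  simp only [Set.mem_setOf_eq, Set.mem_image, mem_rootSet, coe_aeval_eq_eval]
  constructor
  · rintro ⟨h, hN⟩
    refine ⟨r, ⟨RpolyC_ne_zero k c, eval_RpolyC_eq_zero_of_NvalC_eq_zero k c h hN⟩, ?_⟩
    rw [critPointC, fst_eq_critXC_of_NvalC_eq_zero k h2 he hc h hN]
  · rintro ⟨θ, ⟨_, hR⟩, hθ⟩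
    simp only [critPointC, Prod.mk.injEq] at hθ
    obtain ⟨rfl, rfl⟩ := hθ
    exact ⟨critPointC_mem k h2 he hc hR, NvalC_critPointC k h2 he hc hR⟩

/-- The zero set of `N_c` on `D_e` is finite (`c ≠ 0`). [cite: MochizukiGenEll2010, Thm 2.1 proof p.12] -/
theorem zeroSetC_finite (k : ℕ) (h2 : (2 : K) ≠ 0) (he : ((2 * k + 1 : ℕ) : K) ≠ 0) {c : K}
    (hc : c ≠ 0) : {z : K × K | z.2 ^ (2 * k + 1) = z.1 * (1 - z.1) ∧ NvalC k c z = 0}.Finite := by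
  rw [zeroSetC_eq k h2 he hc]
  exact ((RpolyC k c).rootSet_finite K).image _

/-- The number of roots of `R_c` in a field extension is at most `6k + 6 = 3e + 3`.
[cite: MochizukiGenEll2010, Thm 2.1 proof p.12] -/
theorem ncard_rootSetC_le (k : ℕ) (c : K) {L : Type*} [Field L] [Algebra K L] :
    ((RpolyC k c).rootSet L).ncard ≤ 6 * k + 6 := by
  classical
  rw [rootSet_def, Set.ncard_coe_finset]
  refine (Multiset.toFinset_card_le _).trans ?_
  refine (card_roots' _).trans ?_
  exact (natDegree_map_le).trans (natDegree_RpolyC_le k c)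

/-- `N_c` has at most `6k + 6 = 3e + 3` zeros on `D_e` (`= deg R_{t_c}`). [cite: MochizukiGenEll2010, Thm 2.1 proof p.12] -/
theorem zeroSetC_ncard_le (k : ℕ) (h2 : (2 : K) ≠ 0) (he : ((2 * k + 1 : ℕ) : K) ≠ 0) {c : K}
    (hc : c ≠ 0) :
    {z : K × K | z.2 ^ (2 * k + 1) = z.1 * (1 - z.1) ∧ NvalC k c z = 0}.ncard ≤ 6 * k + 6 := by
  rw [zeroSetC_eq k h2 he hc]
  exact (Set.ncard_image_le ((RpolyC k c).rootSet_finite K)).trans (ncard_rootSetC_le k c)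

/-- The zeros of `N_c` avoid the poles of `t_c`: at `Q_θ`, `r = θ ≠ 0` and `s = 1 − 2x_θ ≠ 0`, so
the denominator `r·s` of `t_c` does not vanish. [cite: MochizukiGenEll2010, Thm 2.1 proof p.12] -/
theorem tDen_critPointC_ne_zero (k : ℕ) (h2 : (2 : K) ≠ 0) (he : ((2 * k + 1 : ℕ) : K) ≠ 0)
    {c : K} (hc : c ≠ 0) {θ : K} (hR : (RpolyC k c).eval θ = 0) :
    θ * (1 - 2 * critXC k c θ) ≠ 0 := by
  rw [one_sub_two_mul_critXC k h2]
  exact mul_ne_zero (rootC_ne_zero k c hR)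
    (div_ne_zero (mul_ne_zero hc (alpha_ne_zero_of_rootC k he hc hR))
      (beta_ne_zero_of_rootC k he hc hR))

section Map

variable {L : Type*} [Field L] (f : K →+* L)

/-- `N_c` commutes with ring homomorphisms (`c ↦ f c`). [cite: MochizukiGenEll2010, Thm 2.1 proof p.12] -/
theorem map_NvalC (k : ℕ) (c : K) (z : K × K) :
    f (NvalC k c z) = NvalC k (f c) (f z.1, f z.2) := by
  simp [NvalC, map_alpha, map_ofNat]

/-- Roots of `R_c` map to roots of `R_{f c}` (Galois stability of the critical locus: for `c ∈ ℚ`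
one has `f c = c`). [cite: MochizukiGenEll2010, Thm 2.1 proof p.12] -/
theorem eval_RpolyC_map (k : ℕ) (c θ : K) :
    (RpolyC k (f c)).eval (f θ) = f ((RpolyC k c).eval θ) := by
  rw [eval_RpolyC, eval_RpolyC, map_sub, map_mul, map_pow, map_pow, map_pow, map_alpha, map_beta]

/-- `Q_{f θ} = f(Q_θ)`: the critical points are permuted by field homomorphisms.
[cite: MochizukiGenEll2010, Thm 2.1 proof p.12] -/
theorem map_critXC (k : ℕ) (c θ : K) : f (critXC k c θ) = critXC k (f c) (f θ) := by
  simp [critXC, critSC, map_alpha, map_beta, map_div₀, map_ofNat]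

/-- Membership in the root set of `R_c` over an extension `L ⊇ K` is the vanishing of `R_{c}` read in
`L`. [cite: MochizukiGenEll2010, Thm 2.1 proof p.12] -/
theorem mem_rootSet_RpolyC_iff (k : ℕ) (c : K) [Algebra K L] (θ : L) :
    θ ∈ (RpolyC k c).rootSet L ↔ (RpolyC k (algebraMap K L c)).eval θ = 0 := by
  rw [mem_rootSet', aeval_def, eval₂_eq_eval_map, map_RpolyC]
  simp [RpolyC_ne_zero]

end Map

end Field

end DeCrit

end Literature.NumberTheory.DiophantineGeometry.GenEll

end
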